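import Literature.AlgebraicGeometry.HodgeTheory.SymbolClasses
import Summits.HodgeConjecture.HodgeConjecture.Theorems.MilnorKExponentialSymbolLiftRCupStepChains
import Summits.HodgeConjecture.HodgeConjecture.Theorems.MilnorKExponentialSymbolLiftRReduction

/-!
# `SymbolClassesAlgebraic` (stmt-HodgeConjecture-17743) · Negative · anti-vacuity in every weight of the band

Negative-side bookkeeping for the crux `MilnorKExponential.SymbolClassesAlgebraic` (GK_p), from the
standing disprover's work file `Cruxes/SymbolClassesAlgebraic/Disproof.lean` (§10): the hypothesis of the
crux is SATISFIABLE BY A NON-ZERO CLASS in every weight `1 ≤ q + 1 ≤ dim X` — so GK is nowhere vacuous in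
its band (`Negative/LoadBearing.lean` shows it is empty above the dimension, and gen-1's
`exists_ne_zero_hasSymbolCocycle_of_isSymbolNormalized_zero` did weight `1`).

* `isMilnorSymbolCocycle_symbolCochain` — **the cup powers `[g_{J₀J₁}, …, g_{J_qJ_{q+1}}]` of the
  transition cocycle of a holomorphic line bundle are Milnor symbol cocycles in EVERY weight** (the
  tree had `q = 0`): `L.symbolCochain (q+1)` is the Čech cup product of `L.symbolCochain q` with the
  transition cocycle (`symbolCochain_succ_eq_mulChain`), and cup products of Milnor symbol cocycles are
  Milnor symbol cocycles (`SymbolLiftR.CupStep.isMilnorSymbolCocycle_cupChain`, the Leibniz rule modulo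
  the naive relations).
* `exists_ne_zero_hasSymbolCocycle_of_isSymbolNormalized` — hence a normalisation witness
  `(L, θ₀, c₀)` in degree `2(q+1)` is itself a symbol cocycle for the NON-ZERO RATIONAL class `c₀`
  (with `m = 1`), in every weight.
* `exists_ne_zero_isSymbolClass` / `exists_ne_zero_routeHypothesis` — with the landed existence of
  symbol-normalised models in every degree `2(q+1) ≤ 2 dim X` (`SymbolLiftR.normalisedModelsExist`): on
  every smooth projective `n`-fold and for every `q + 1 ≤ n` there is a non-zero rational class
  satisfying the hypothesis of the crux, in the named form AND in the route's inlined shape. So no proof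
  of GK can succeed "for lack of symbol classes", and a disproof must beat a genuinely inhabited
  hypothesis.
Refuter seat refuter-cdisprove-stmt-HodgeConjecture-17743-g2-0 (cdisprove gen 2, cycle 1), 2026-08-17.
-/

noncomputable section

-- The mandated namespace `Summit.<P>.<Sub>.Theorems.…` repeats `HodgeConjecture` (single-conjunct summit).
set_option linter.dupNamespace false

namespace Summit.HodgeConjecture.HodgeConjecture.Theorems.SymbolClassesAlgebraic.Negative.BandAntiVacuity

open scoped Manifold
open Literature.AlgebraicGeometry.HodgeTheory Literature.AlgebraicGeometry.Motives
  Literature.Geometry.Kaehler Literature.NumberTheory.Transcendental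
open Literature.AlgebraicGeometry.Modules
open Summit.HodgeConjecture.HodgeConjecture.Theorems.SymbolLiftR (normalisedModelsExist)
open Summit.HodgeConjecture.HodgeConjecture.Theorems.SymbolLiftR.CupStep

/-! ### The cup powers of a transition cocycle are Milnor symbol cocycles, in every weight -/

section Cocycle

variable {M : Type*} {E : Type*} [NormedAddCommGroup E] [NormedSpace ℂ E] [TopologicalSpace M]
  [ChartedSpace E M] {ι : Type*}

/-- **`L.symbolCochain (q+1)` is the Čech cup product of `L.symbolCochain q` with the transition
cocycle**: on `U_{J₀} ∩ ⋯ ∩ U_{J_{q+2}}` the single symbol `[g_{J₀J₁}, …, g_{J_{q+1}J_{q+2}}]` is the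
front symbol `[g_{J₀J₁}, …, g_{J_qJ_{q+1}}]` times the back edge `[g_{J_{q+1}J_{q+2}}]`
(`CupStep.mulChain`, concatenation of tuples). [cite: BottTu1982Forms, §8 (8.4)] -/
theorem symbolCochain_succ_eq_mulChain (L : HolomorphicLineBundle ι E M) (q : ℕ) (J : Fin (q + 3) → ι) :
    L.symbolCochain (q + 1) J =
      mulChain (q + 1) (L.symbolCochain q (J ∘ Fin.castSucc)) (L.symbolCochain 0 (Cech.back (q + 1) J)) := by
  rw [HolomorphicLineBundle.symbolCochain_apply, HolomorphicLineBundle.symbolCochain_apply,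
    HolomorphicLineBundle.symbolCochain_apply, mulChain_single_single, mul_one]
  congr 1
  funext i
  refine Fin.lastCases ?_ (fun j ↦ ?_) i
  · rw [Fin.snoc_last]
    rfl
  · rw [Fin.snoc_castSucc]
    rfl

/-- **The cup powers of the transition cocycle of a holomorphic line bundle are Milnor symbol
cocycles in every weight** (`q = 0`: the tree's `isMilnorSymbolCocycle_symbolCochain_zero`; step:
`symbolCochain_succ_eq_mulChain` and the Leibniz rule `isMilnorSymbolCocycle_cupChain`).
[cite: BottTu1982Forms, §8 (8.4)] [cite: VoisinHodgeI2002, Thm. 4.49] -/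
theorem isMilnorSymbolCocycle_symbolCochain (L : HolomorphicLineBundle ι E M) (q : ℕ) :
    IsMilnorSymbolCocycle E L.baseSet (L.symbolCochain q) := by
  induction q with
  | zero => exact L.isMilnorSymbolCocycle_symbolCochain_zero
  | succ q ih =>
    have e : L.symbolCochain (q + 1) = fun J ↦
        mulChain (q + 1) (L.symbolCochain q (J ∘ Fin.castSucc)) (L.symbolCochain 0 (Cech.back (q + 1) J)) :=
      funext (symbolCochain_succ_eq_mulChain L q)
    rw [e]
    exact isMilnorSymbolCocycle_cupChain ih L.isMilnorSymbolCocycle_symbolCochain_zero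

end Cocycle

/-! ### Every symbol-normalised model carries a non-zero rational symbol class of that weight -/

variable {n : ℕ} {X : SchemeOver ℂ}

/-- **A normalisation witness in degree `2(q+1)` is a symbol cocycle for a non-zero rational class,
in every weight**: if `A.IsSymbolNormalized q` via `(L, θ₀, c₀)`, then `c₀ ≠ 0` is rational and
`A.HasSymbolCocycle q c₀` with the cocycle `L.symbolCochain q` (`isMilnorSymbolCocycle_symbolCochain`),
the same zig-zag and `m = 1`. [cite: VoisinHodgeI2002, Thm. 7.10 (proof)] -/
theorem exists_ne_zero_hasSymbolCocycle_of_isSymbolNormalized (A : HodgeModel n X) {q : ℕ}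
    (hN : A.IsSymbolNormalized q) :
    ∃ c₀ : complexBetti X (2 * (q + 1)), IsRationalClass c₀ ∧ c₀ ≠ 0 ∧ A.HasSymbolCocycle q c₀ := by
  obtain ⟨ι, hι, L, θ₀, c₀, hT, hc₀, hne, hdR⟩ := hN
  refine ⟨c₀, hc₀, hne, ι, hι, L.baseSet, L.isOpen_baseSet, L.exists_mem_baseSet, L.symbolCochain q,
    isMilnorSymbolCocycle_symbolCochain L q, θ₀, 1, one_ne_zero, hT, ?_⟩
  rw [hdR, Int.cast_one, one_smul]

/-- **GK is nowhere vacuous in its band**: on a smooth projective complex `n`-fold, for every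
`q + 1 ≤ n` there is a NON-ZERO RATIONAL symbol class of weight `q + 1` (`IsSymbolClass`), carried on a
symbol-normalised model (`SymbolLiftR.normalisedModelsExist`) by the cup power of a transition cocycle.
[cite: VoisinHodgeI2002, Thm. 7.10 (proof) and Cor. 3.9] -/
theorem exists_ne_zero_isSymbolClass (hX : IsSmoothProjective n X) (q : ℕ) (hq : q + 1 ≤ n) :
    ∃ c : complexBetti X (2 * (q + 1)), IsRationalClass c ∧ c ≠ 0 ∧ IsSymbolClass n X q c := by
  obtain ⟨A, hN⟩ := normalisedModelsExist hX q hq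
  obtain ⟨c, hc, hne, hS⟩ := exists_ne_zero_hasSymbolCocycle_of_isSymbolNormalized A hN
  exact ⟨c, hc, hne, IsSymbolClass.of_hasSymbolCocycle A hN hS⟩

/-- **The route's inlined hypothesis is satisfiable by a non-zero class in every weight of the
band**: for `q + 1 ≤ n` some non-zero rational `c` admits a Hodge model `A` with
`A.IsSymbolNormalized q ∧ A.HasSymbolCocycle q c` — componentwise definitionally the hypothesis of the
route decl `SymbolClassesAlgebraic` (`Negative/Ceiling.named_of_symbolClassesAlgebraic`). A proof of
GK therefore has genuine instances to treat in every `(n, q + 1)` with `1 ≤ q + 1 ≤ n`, the first open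
one being `(4, 2)`. [cite: VoisinHodgeI2002, Thm. 7.10 (proof) and Cor. 3.9] -/
theorem exists_ne_zero_routeHypothesis (hX : IsSmoothProjective n X) (q : ℕ) (hq : q + 1 ≤ n) :
    ∃ c : complexBetti X (2 * (q + 1)), IsRationalClass c ∧ c ≠ 0 ∧
      ∃ A : HodgeModel n X, A.IsSymbolNormalized q ∧ A.HasSymbolCocycle q c := by
  obtain ⟨A, hN⟩ := normalisedModelsExist hX q hq
  obtain ⟨c, hc, hne, hS⟩ := exists_ne_zero_hasSymbolCocycle_of_isSymbolNormalized A hN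
  exact ⟨c, hc, hne, A, hN, hS⟩

end Summit.HodgeConjecture.HodgeConjecture.Theorems.SymbolClassesAlgebraic.Negative.BandAntiVacuity

end
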